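import Summits.BirchSwinnertonDyer.BirchSwinnertonDyer.Theorems.AlignedTransportAtTwoMainConjectureOfRankZeroBSDAtTwoTwistOrbitReverseSelmerStable
import Literature.NumberTheory.QuadraticFields.KroneckerSplitting
import HarnessLib

/-!
# Route `AlignedTransportAtTwo`, crux C2 `MainConjectureOfRankZeroBSDAtTwo` (stmt-BirchSwinnertonDyer-22298):
# THE SECOND HALF OF THE SATURATION-CLASS LAW — `2`-Selmer rank is constant along the clean-shape twists `d ≡ 1 (mod 8)` of a base that
# may be ADDITIVE at `2` (Mazur–Rubin Lemma 2.10 with (i) «`2` splits» at `2`, PROVED in the tree); hence the DARK-CLASS THEOREM: if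
# `Sel₂` of (a model of) `A⁽²⁾` is trivial, then `rank A^{(2d)}(ℚ) = 0` for every clean-shape `d ≡ 1 (8)` — no clean member of the class is
# twist-saturated, and neither gen 46's door nor the reverse door can fire on it

HONEST FRAMING (cell `bsd-f1-sign2`, WIDTH-5 attached prover seat `bsd-line-att-p5` gen 48; `--supports` stmt-BirchSwinnertonDyer-22298, closes nothing;
BSD is NOT proved; the crux, its verdict and every stub are untouched). THEOREMS ONLY. UNCONDITIONAL (the Mazur–Rubin input is the tree theorem
`MazurRubin2010.d2_eq_of_lemma210_rat_holds`; the splitting of `2` in `ℚ(√d)` for `d ≡ 1 (mod 8)` is the tree's `Quadratic.ncard_primesOver_two_eq_two_iff`).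

* §1 ★★★ `natCard_selmerGroup_two_twist_eq_of_cleanShape_splitTwo`: base `B/ℚ` globally minimal, ARBITRARY at `2`, multiplicative with odd
  `ord_ℓ Δ` at every ODD bad prime; `d` square-free, `≠ 1`, `≡ 1 (mod 8)`, its primes good for `B` with `B`'s `2`-division cubic root-free there,
  `0 < d ∨ Δ_B < 0`; then `#Sel₂(B^{(d)}) = #Sel₂(B)` for every model. (Companion of `natCard_selmerGroup_two_twist_eq_of_cleanShape`, which needs
  `B` good at `2` but allows `d ≡ 5 (8)`.)
* §2 ★★★ `mordellWeilRank_twist_eq_zero_of_dark`: if moreover `#Sel₂(B) = 1` then every such twist has `#Sel₂ = 1` and Mordell–Weil rank `0`.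
* §3 the bridge to the doors' objects (`B` a model of `A⁽²⁾`, `W` of `A^{(d)}`, `W₂` of `W⁽²⁾` ⟹ `W₂` is a model of `B^{(d)}`) and ★★★
  `mordellWeilRank_twistOfTwist_eq_zero_of_dark`: for a DARK anchor (`#Sel₂` of a model of `A⁽²⁾` equal to `1`) and every clean-shape `d ≡ 1 (8)`,
  `rank_ℤ W₂(ℚ) = 0` — so the saturation hypothesis `2·ord₂ #W̃(𝔽₂) ≤ rank_ℤ W₂(ℚ)` of `mazurMainConjecture_two_of_cleanShape_twist` (and of gen 46's
  own door at `W`) FAILS for every clean-shape member: the census' 113 + 53 dark classes are provably out of reach of the weight-`2` doors.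
References: [MazurRubin2010] Lemma 2.10 (i)–(v), Cor. 3.4 (ii); [Kramer1981] Props. 1, 2 (a); [SilvermanAEC2009] X.4.2, X.5 Cor. 5.4.
-/

set_option linter.dupNamespace false
set_option autoImplicit false

noncomputable section

open scoped Classical MatrixGroups ModularForm

namespace Summit.BirchSwinnertonDyer.BirchSwinnertonDyer.Theorems.AlignedTransportAtTwoTwistOrbit

open PowerSeries CongruenceSubgroup WeierstrassCurve NumberField Literature.NumberTheory.EllipticCurves
  Literature.NumberTheory.EllipticCurves.ModularForms
  Literature.NumberTheory.EllipticCurves.Rank1Residual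
  Literature.NumberTheory.EllipticCurves.Greenberg1999
  Literature.NumberTheory.QuadraticFields
  Summit.BirchSwinnertonDyer.Rank1Residual
  Summit.BirchSwinnertonDyer.Rank1Residual.X5
  Summit.BirchSwinnertonDyer.Rank1Residual.X5.O1
  Summit.BirchSwinnertonDyer.BirchSwinnertonDyer.Theorems.GenusKolyTwin

variable (B W : WeierstrassCurve ℚ) [B.IsElliptic] [B.IsGloballyMinimal] [W.IsElliptic] {d : ℤ}

/-! ## §1 ★★★ Constancy of `#Sel₂` along clean-shape twists `d ≡ 1 (mod 8)` of a base arbitrary at `2` -/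

/-- ★★★ **`#Sel₂(B^{(d)}/ℚ) = #Sel₂(B/ℚ)` for `d ≡ 1 (mod 8)` clean-shape — base ARBITRARY at `2`, UNCONDITIONAL.** `B/ℚ` globally minimal;
every ODD prime of `Δ_min(B)` is multiplicative with `ord_ℓ Δ(B)` odd; `d` square-free, `d ≠ 1`, `d ≡ 1 (mod 8)` (so `2` SPLITS in `ℚ(√d)`:
Lemma 2.10 (i) at `2`, whatever the reduction of `B` there), every prime of `d` good for `B` with `B`'s `2`-division cubic root-free mod it
(`B(ℚ_ℓ)[2] = 0`, Lemma 2.10 (ii)), `0 < d ∨ Δ(B) < 0` (the real place); `W` any model of `B^{(d)}`. [cite: MazurRubin2010, Lemma 2.10 (i)–(v) with Def. 2.3; Cor. 3.4 (ii)]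
[cite: Kramer1981, Props. 1, 2 (a), 7] -/
theorem natCard_selmerGroup_two_twist_eq_of_cleanShape_splitTwo
    (hmult : ∀ (p : ℕ) [Fact p.Prime], p ≠ 2 → (p : ℤ) ∣ minimalDiscriminantInt B →
      B.HasMultiplicativeReductionAtPrime p ∧ Odd (padicValRat p B.Δ))
    (hsq : Squarefree d) (hd1 : d ≠ 1) (hd8 : d % 8 = 1)
    (hcop : ∀ (p : ℕ) [Fact p.Prime], (p : ℤ) ∣ d → ¬ (p : ℤ) ∣ minimalDiscriminantInt B) (hsgn : 0 < d ∨ B.Δ < 0)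
    (hroot : ∀ (p : ℕ) [Fact p.Prime], (p : ℤ) ∣ d → ∀ x : ZMod p,
      4 * x ^ 3 + ((integralModelInt B).b₂ : ZMod p) * x ^ 2 + 2 * ((integralModelInt B).b₄ : ZMod p) * x + ((integralModelInt B).b₆ : ZMod p) ≠ 0)
    (hW : ∃ C : VariableChange ℚ, C • B.quadraticTwist (d : ℚ) = W) :
    Nat.card (W.selmerGroup 2) = Nat.card (B.selmerGroup 2) := by
  have hd4 : d % 4 = 1 := by omega
  obtain ⟨F, _, _, h2, hdisc⟩ := Quadratic.exists_numberField_discr_eq (D := d) (Or.inl ⟨hd4, hsq, hd1⟩)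
  obtain ⟨-, -, δ, -, hδ⟩ := Quadratic.exists_sq_eq_discr (K := F) h2
  have hx : ∃ x : F, x ^ 2 = (d : F) := by
    refine ⟨(δ : F), ?_⟩
    have h := congrArg ((↑) : 𝓞 F → F) hδ
    push_cast at h
    rw [h, hdisc]
    norm_cast
  obtain ⟨C, hC⟩ := hW
  have hW' : ∃ C' : VariableChange ℚ, C' • W = B.quadraticTwist (d : ℚ) :=
    ⟨C⁻¹, by rw [← hC, smul_smul, inv_mul_cancel, one_smul]⟩
  have hd2 : ¬ (2 : ℤ) ∣ d := by omega
  refine MazurRubin2010.d2_eq_of_lemma210_rat_holds B d hsq hd1 F h2 hx ?_ ?_ W hW'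
  · intro p _
    have hp : p.Prime := Fact.out
    by_cases hp2 : p = 2
    · -- (i): `2` splits in `F` (`d_F = d ≡ 1 (mod 8)`)
      subst hp2
      exact Or.inl ((Quadratic.ncard_primesOver_two_eq_two_iff h2).mpr (by rw [hdisc]; exact hd8))
    by_cases hpd : (p : ℤ) ∣ d
    · -- (ii): a prime of `d`
      exact Or.inr (Or.inl ⟨hp2, GenusKolyTwin.twoTorsion_padic_eq_zero_of_forall_ne B hp2 (hcop p hpd) (hroot p hpd)⟩)
    · by_cases hpΔ : (p : ℤ) ∣ minimalDiscriminantInt B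
      · -- (iii): an odd bad prime of `B`
        obtain ⟨hm, ho⟩ := hmult p hp2 hpΔ
        exact Or.inr (Or.inr (Or.inl ⟨hm, by rw [hdisc]; exact hpd, ho⟩))
      · -- (v): a good prime unramified in `F`
        exact Or.inr (Or.inr (Or.inr ⟨hasGoodReductionAtPrime_of_not_dvd B p hpΔ, by rw [hdisc]; exact hpd⟩))
  · rcases hsgn with hdpos | hΔ
    · left
      have hdF : 0 < NumberField.discr F := by rw [hdisc]; exact hdpos
      exact NumberField.nrComplexPlaces_eq_zero_iff.mp (Quadratic.nrRealPlaces_eq_two_and_nrComplexPlaces_eq_zero h2 hdF).2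
    · exact Or.inr hΔ

/-! ## §2 ★★★ The dark-class theorem: trivial `Sel₂` propagates, so every clean-shape twist has rank `0` -/

/-- ★★★ **DARK BASE ⟹ DARK CLASS.** Under the hypotheses of `natCard_selmerGroup_two_twist_eq_of_cleanShape_splitTwo`, if `#Sel₂(B/ℚ) = 1` then every
clean-shape twist `W` (`d ≡ 1 (mod 8)`) has `#Sel₂(W/ℚ) = 1` and `rank W(ℚ) = 0`. [cite: MazurRubin2010, Lemma 2.10, Cor. 3.4 (ii)] [cite: SilvermanAEC2009, Thm. X.4.2] -/
theorem mordellWeilRank_twist_eq_zero_of_dark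
    (hmult : ∀ (p : ℕ) [Fact p.Prime], p ≠ 2 → (p : ℤ) ∣ minimalDiscriminantInt B →
      B.HasMultiplicativeReductionAtPrime p ∧ Odd (padicValRat p B.Δ))
    (hsq : Squarefree d) (hd1 : d ≠ 1) (hd8 : d % 8 = 1)
    (hcop : ∀ (p : ℕ) [Fact p.Prime], (p : ℤ) ∣ d → ¬ (p : ℤ) ∣ minimalDiscriminantInt B) (hsgn : 0 < d ∨ B.Δ < 0)
    (hroot : ∀ (p : ℕ) [Fact p.Prime], (p : ℤ) ∣ d → ∀ x : ZMod p,
      4 * x ^ 3 + ((integralModelInt B).b₂ : ZMod p) * x ^ 2 + 2 * ((integralModelInt B).b₄ : ZMod p) * x + ((integralModelInt B).b₆ : ZMod p) ≠ 0)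
    (hW : ∃ C : VariableChange ℚ, C • B.quadraticTwist (d : ℚ) = W) (hdark : Nat.card (B.selmerGroup 2) = 1) :
    Nat.card (W.selmerGroup 2) = 1 ∧ W.mordellWeilRank = 0 := by
  haveI : Fact (Nat.Prime 2) := ⟨Nat.prime_two⟩
  have h1 : Nat.card (W.selmerGroup 2) = 1 := by
    rw [natCard_selmerGroup_two_twist_eq_of_cleanShape_splitTwo B W hmult hsq hd1 hd8 hcop hsgn hroot hW, hdark]
  exact ⟨h1, (rank_eq_zero_and_torsionBy_eq_bot_and_sha_inf_torsionBy_eq_bot_of_natCard_selmerGroup_eq_one W 2 h1).1⟩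

/-! ## §3 The bridge to the doors' objects and the dark-class theorem for anchors -/

omit [B.IsElliptic] [B.IsGloballyMinimal] [W.IsElliptic] in
/-- **`W₂` is a model of `B^{(d)}`**: if `B` is a model of `A⁽²⁾` (`C_B • A.quadraticTwist 2 = B`), `W` a model of `A^{(d)}` (`C_W • A.quadraticTwist d = W`)
and `V • W₂ = W.quadraticTwist 2`, then `C • B.quadraticTwist d = W₂` for some `C` (`(A^{(d)})^{(2)} = A^{(2d)} = (A^{(2)})^{(d)}`; tree
`quadraticTwist_smul`, `quadraticTwist_quadraticTwist`). [cite: SilvermanAEC2009, X.2 Prop. 2.4, X.5 Cor. 5.4] -/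
theorem exists_smul_quadraticTwist_eq_twistTwo (A W₂ : WeierstrassCurve ℚ) {C_B C_W V : VariableChange ℚ}
    (hB : C_B • A.quadraticTwist (2 : ℚ) = B) (hWd : C_W • A.quadraticTwist (d : ℚ) = W) (hV : V • W₂ = W.quadraticTwist 2) :
    ∃ C : VariableChange ℚ, C • B.quadraticTwist (d : ℚ) = W₂ := by
  have h2 : (2 : ℚ) ≠ 0 := two_ne_zero
  -- `W.quadraticTwist 2 = c₁ • A.quadraticTwist (2d)` and `B.quadraticTwist d = c₂ • A.quadraticTwist (2d)`
  have hW2 : W.quadraticTwist 2 = (⟨C_W.u, (2 : ℚ) * C_W.r, 0, 0⟩ : VariableChange ℚ) • A.quadraticTwist ((d : ℚ) * 2) := by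
    rw [← hWd, Greenberg1999.quadraticTwist_smul _ _ _ h2, quadraticTwist_quadraticTwist]
  have hBd : B.quadraticTwist (d : ℚ) = (⟨C_B.u, (d : ℚ) * C_B.r, 0, 0⟩ : VariableChange ℚ) • A.quadraticTwist ((d : ℚ) * 2) := by
    rw [← hB, Greenberg1999.quadraticTwist_smul _ _ _ h2, quadraticTwist_quadraticTwist, mul_comm (2 : ℚ) (d : ℚ)]
  set c₁ : VariableChange ℚ := ⟨C_W.u, (2 : ℚ) * C_W.r, 0, 0⟩
  set c₂ : VariableChange ℚ := ⟨C_B.u, (d : ℚ) * C_B.r, 0, 0⟩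
  refine ⟨V⁻¹ * c₁ * c₂⁻¹, ?_⟩
  rw [hBd, ← smul_smul, ← smul_smul, smul_smul c₂⁻¹, inv_mul_cancel, one_smul, ← hW2, ← hV, smul_smul, inv_mul_cancel, one_smul]

omit [W.IsElliptic] in
/-- ★★★ **THE DARK-CLASS THEOREM FOR ANCHORS.** Let `B` be a globally minimal model of `A⁽²⁾` whose odd bad primes are multiplicative with odd
`ord_ℓ Δ(B)`, and suppose the class is DARK: `#Sel₂(B/ℚ) = 1`. Then for every clean-shape `d ≡ 1 (mod 8)` (square-free, `≠ 1`, primes good for `B`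
with `B`'s cubic root-free, `0 < d ∨ Δ_B < 0`), every model `W` of `A^{(d)}` and every `ℚ`-model `W₂` of `W⁽²⁾`: **`rank_ℤ W₂(ℚ) = 0`** — in particular
the saturation hypothesis `2 ≤ rank_ℤ W₂(ℚ)` of the reverse door (and of gen 46's door at `W`) fails for EVERY clean-shape member of the class.
[cite: MazurRubin2010, Lemma 2.10, Cor. 3.4 (ii)] [cite: SilvermanAEC2009, Thm. X.4.2, X.5 Cor. 5.4] -/
theorem mordellWeilRank_twistOfTwist_eq_zero_of_dark (A W₂ : WeierstrassCurve ℚ) [W₂.IsElliptic]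
    (hmult : ∀ (p : ℕ) [Fact p.Prime], p ≠ 2 → (p : ℤ) ∣ minimalDiscriminantInt B →
      B.HasMultiplicativeReductionAtPrime p ∧ Odd (padicValRat p B.Δ))
    (hdark : Nat.card (B.selmerGroup 2) = 1)
    (hsq : Squarefree d) (hd1 : d ≠ 1) (hd8 : d % 8 = 1)
    (hcop : ∀ (p : ℕ) [Fact p.Prime], (p : ℤ) ∣ d → ¬ (p : ℤ) ∣ minimalDiscriminantInt B) (hsgn : 0 < d ∨ B.Δ < 0)
    (hroot : ∀ (p : ℕ) [Fact p.Prime], (p : ℤ) ∣ d → ∀ x : ZMod p,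
      4 * x ^ 3 + ((integralModelInt B).b₂ : ZMod p) * x ^ 2 + 2 * ((integralModelInt B).b₄ : ZMod p) * x + ((integralModelInt B).b₆ : ZMod p) ≠ 0)
    {C_B C_W V : VariableChange ℚ} (hB : C_B • A.quadraticTwist (2 : ℚ) = B) (hWd : C_W • A.quadraticTwist (d : ℚ) = W)
    (hV : V • W₂ = W.quadraticTwist 2) :
    W₂.mordellWeilRank = 0 ∧ ¬ 2 ≤ W₂.mordellWeilRank := by
  have hW₂ := exists_smul_quadraticTwist_eq_twistTwo B W A W₂ hB hWd hV
  have h := (mordellWeilRank_twist_eq_zero_of_dark B W₂ hmult hsq hd1 hd8 hcop hsgn hroot hW₂ hdark).2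
  exact ⟨h, by omega⟩

end Summit.BirchSwinnertonDyer.BirchSwinnertonDyer.Theorems.AlignedTransportAtTwoTwistOrbit

end
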